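import Mathlib
import HarnessLib
import Literature.Probability.MarkovChains.MarkovChainDecomposition

/-!
HONEST FRAMING: exact (Metropolis-corrected) sampling algorithms for lattice gauge theory; figures
of merit are autocorrelation/cost numbers at stated couplings and volumes; no continuum-physics
claim.

# SimulatedTemperingFiniteSampler — THE RANDOM-SCAN SIMULATED-TEMPERING SAMPLER ON A FINITE
# CONFIGURATION SPACE AS ONE FINITE REVERSIBLE CHAIN, AND ITS BLOCK STRUCTURE ALONG THE LEVELS
# (restriction chains = the within-level updates, projection chain = the overlap ladder walk)
# (lean-2 GEN-16, ours)

Venture-side (OURS).  Cell `lqcd-flow` (pub-lqcd), unit `pub-lqcd-lean-2-g16`, 2026-08-24.  GEN-13–15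
(`Scaling/SimulatedTempering*`, Mathlib `Kernel`s on a general configuration space) proved FLOORS on the
autocorrelations of the coupling index valid WHATEVER the within-level update is; a CEILING must see that
update.  This chapter (`SimulatedTemperingFinite*`) takes a FINITE configuration space `S` (a finite gauge group
on a finite lattice, or any finite discretisation): the sampler is one finite reversible matrix and the
Literature's decomposition theorem (Jerrum–Son–Tetali–Vigoda 2004, PROVED in
`Literature/Probability/MarkovChains/MarkovChainDecomposition`) applies with the LEVELS AS BLOCKS.

Objects (finite-chain vocabulary of `Literature.Probability.MarkovChains`): levels `k : Fin (K+1)`, level laws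
`μ k : S → ℝ` (positive probability vectors; EXACT weights: the target `stFinLaw μ (k,x) = μ_k(x)/(K+1)` gives
every level mass `1/(K+1)`), within-level updates `M k : Matrix S S ℝ` (row-stochastic, `μ k`-reversible —
heat bath, Metropolis, HMC, a Metropolis-corrected flow: anything exact); `stFinProposal` keeps `x` and proposes
each ADJACENT level (`|i − j| = 1`) w.p. `½`; `stFinLevel μ = mhKernel stFinProposal (stFinLaw μ)` is the
Metropolis level move (accept `k → l` w.p. `min{1, μ_l(x)/μ_k(x)}`; finite twin of
`Scaling/SimulatedTemperingLevelKernel`); `stFinWithin M ((k,x),(l,y)) = [l = k]·M_k(x,y)` (twin of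
`Scaling/SimulatedTemperingWithinLevel`); `stFinSampler t μ M = t·stFinLevel μ + (1 − t)·stFinWithin M`;
`stFinOverlap μ i j = Σ_x min{μ_i(x), μ_j(x)}`.

Proved: §1–§3 — `stFinLevel`, `stFinWithin`, `stFinSampler` (`0 ≤ t ≤ 1`) are row-stochastic and in DETAILED
BALANCE with `stFinLaw μ`; `stFinLaw_mul_stFinLevel` (`π(p)L(p,q) = [same x, adjacent]·min{μ_i(x),μ_j(x)}/(2(K+1))`);
the level move never changes `x`.  §4 — THE BLOCK STRUCTURE for `blk = Prod.fst`: `blockMass = 1/(K+1)`,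
`blockLaw k = μ_k` on level `k`, block variances are `μ_k`-variances of the slice, the one-step ESCAPE
probability is `≤ t` (`stFin_escapeProb_le`), the RESTRICTION chain's Dirichlet form on level `k` is EXACTLY
`(1 − t)·𝓔_{μ_k}(M_k; f(k,·))` (`stFin_dirichletForm_restriction`), and the inter-block FLOW is
`[adjacent]·t·stFinOverlap μ i j/(2(K+1))` (`stFin_blockFlow_of_ne`): the projection chain is the lazy overlap
ladder walk and the within-level updates are invisible to it.  The Poincaré constants, the spectral-gap floor
and the asymptotic-variance CEILING are assembled in `Scaling/SimulatedTemperingFiniteGap`.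

NOT CLAIMED: general (non-finite) configuration spaces (the `Kernel` files give the floors there); the
deterministic scans `W∘L`, `L∘W` (not reversible); replica exchange (its restriction chains are product chains —
a tensorisation step the tree does not have); anything measured.  Literature grade (cell rule): TEXTBOOK ALGORITHM
(Marinari–Parisi 1992, Geyer–Thompson 1995) + KNOWN MECHANISM (decomposition bounds for tempering: Madras–Randall
2002, Woodard–Schmidler–Huber 2009), NEW TYPING; nothing cited as a fact; no new bib keys.
-/

noncomputable section

open Finset
open Literature.Probability.MarkovChains
open Literature.Probability.MarkovChains.Decomposition

namespace Summit.Ventures.LatticeQCDFlow.Scaling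

variable {S : Type*} [Fintype S] [DecidableEq S] {K : ℕ}

/-! ## §1 The target, the ladder proposal, the overlaps -/

/-- The simulated-tempering target with EXACT weights on a finite configuration space:
`π(k,x) = μ_k(x)/(K+1)`. [ours] -/
def stFinLaw (μ : Fin (K + 1) → S → ℝ) (p : Fin (K + 1) × S) : ℝ := μ p.1 p.2 / (K + 1)

/-- A level has at most two neighbours on the ladder (`|i − j| = 1`). [ours] -/
theorem card_filter_adj_le (i : Fin (K + 1)) :
    (univ.filter fun j : Fin (K + 1) => j.val = i.val + 1 ∨ i.val = j.val + 1).card ≤ 2 := by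
  calc (univ.filter fun j : Fin (K + 1) => j.val = i.val + 1 ∨ i.val = j.val + 1).card
      ≤ ({i.val + 1, i.val - 1} : Finset ℕ).card := by
        refine Finset.card_le_card_of_injOn (fun j : Fin (K + 1) => (j : ℕ)) (fun j hj => ?_)
          (fun a _ b _ hab => Fin.ext hab)
        have hj' : j.val = i.val + 1 ∨ i.val = j.val + 1 := by simpa using hj
        simp only [Finset.coe_insert, Finset.coe_singleton, Set.mem_insert_iff, Set.mem_singleton_iff]
        omega
    _ ≤ 2 := Finset.card_le_two

/-- The ladder proposal: keep the configuration, propose each adjacent level with probability `½`.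
[ours] -/
def stFinProposal (p q : Fin (K + 1) × S) : ℝ :=
  if q.2 = p.2 ∧ (q.1.val = p.1.val + 1 ∨ p.1.val = q.1.val + 1) then 1 / 2 else 0

omit [Fintype S] in
/-- The proposal is symmetric. [ours] -/
theorem stFinProposal_symm (p q : Fin (K + 1) × S) : stFinProposal p q = stFinProposal q p := by
  unfold stFinProposal
  have h : (q.2 = p.2 ∧ (q.1.val = p.1.val + 1 ∨ p.1.val = q.1.val + 1))
      ↔ (p.2 = q.2 ∧ (p.1.val = q.1.val + 1 ∨ q.1.val = p.1.val + 1)) :=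
    ⟨fun h => ⟨h.1.symm, h.2.symm⟩, fun h => ⟨h.1.symm, h.2.symm⟩⟩
  rw [if_congr h rfl rfl]

omit [Fintype S] in
/-- The proposal is non-negative. [ours] -/
theorem stFinProposal_nonneg (p q : Fin (K + 1) × S) : 0 ≤ stFinProposal p q := by
  unfold stFinProposal
  split_ifs <;> norm_num

/-- The proposal has row mass `½·#{adjacent levels} ≤ 1`. [ours] -/
theorem sum_stFinProposal_le_one (p : Fin (K + 1) × S) : ∑ q, stFinProposal p q ≤ 1 := by
  unfold stFinProposal
  rw [Fintype.sum_prod_type]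
  have h : ∀ l : Fin (K + 1),
      ∑ y : S, (if y = p.2 ∧ (l.val = p.1.val + 1 ∨ p.1.val = l.val + 1) then (1 / 2 : ℝ) else 0)
      = if (l.val = p.1.val + 1 ∨ p.1.val = l.val + 1) then 1 / 2 else 0 := by
    intro l
    simp_rw [ite_and]
    rw [Finset.sum_ite_eq' univ p.2]
    simp
  simp_rw [h]
  rw [← Finset.sum_filter, Finset.sum_const, nsmul_eq_mul]
  have hc := card_filter_adj_le p.1
  have : ((univ.filter fun j : Fin (K + 1) => j.val = p.1.val + 1 ∨ p.1.val = j.val + 1).card : ℝ) ≤ 2 := by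
    exact_mod_cast hc
  linarith

/-- The overlap `Σ_x min{μ_i(x), μ_j(x)}` of two levels. [ours] -/
def stFinOverlap (μ : Fin (K + 1) → S → ℝ) (i j : Fin (K + 1)) : ℝ := ∑ x, min (μ i x) (μ j x)

section Basic

variable {μ : Fin (K + 1) → S → ℝ}

omit [Fintype S] [DecidableEq S] in
/-- The target is positive when the level laws are. [ours] -/
theorem stFinLaw_pos (hμ : ∀ k x, 0 < μ k x) (p : Fin (K + 1) × S) : 0 < stFinLaw μ p :=
  div_pos (hμ p.1 p.2) (by positivity)

omit [DecidableEq S] in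
/-- The target is a probability vector when the level laws are. [ours] -/
theorem sum_stFinLaw (hμ1 : ∀ k, ∑ x, μ k x = 1) : ∑ p, stFinLaw μ p = 1 := by
  unfold stFinLaw
  rw [Fintype.sum_prod_type]
  simp_rw [← Finset.sum_div, hμ1]
  rw [Finset.sum_const, Finset.card_univ, Fintype.card_fin, nsmul_eq_mul, mul_one]
  push_cast
  exact div_self (by positivity)

/-! ## §2 The Metropolis level move -/

/-- The Metropolis level move with exact weights: propose an adjacent level w.p. `½`, accept with
probability `min{1, μ_l(x)/μ_k(x)}` — the tree's Metropolis–Hastings kernel of the ladder proposal for the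
target `stFinLaw μ`. [ours] -/
def stFinLevel (μ : Fin (K + 1) → S → ℝ) : Matrix (Fin (K + 1) × S) (Fin (K + 1) × S) ℝ :=
  mhKernel stFinProposal (stFinLaw μ)

/-- The level move is in detailed balance with the target. [ours] -/
theorem stFinLevel_detailedBalance (hμ : ∀ k x, 0 < μ k x) :
    DetailedBalance (stFinLaw μ) (stFinLevel μ) :=
  mhKernel_detailedBalance (stFinLaw_pos hμ) _

/-- The level move is a transition matrix. [ours] -/
theorem stFinLevel_isRowStochastic (hμ : ∀ k x, 0 < μ k x) : IsRowStochastic (stFinLevel μ) :=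
  ⟨mhKernel_nonneg stFinProposal_nonneg sum_stFinProposal_le_one (stFinLaw_pos hμ),
    mhKernel_sum_eq_one _ _⟩

/-- Off the diagonal, `π(p)·L(p,q) = [q keeps the configuration, levels adjacent]·min{μ_i(x), μ_j(x)}/(2(K+1))`.
[ours] -/
theorem stFinLaw_mul_stFinLevel (hμ : ∀ k x, 0 < μ k x) {p q : Fin (K + 1) × S} (hqp : q ≠ p) :
    stFinLaw μ p * stFinLevel μ p q
      = if q.2 = p.2 ∧ (q.1.val = p.1.val + 1 ∨ p.1.val = q.1.val + 1)
          then min (μ p.1 p.2) (μ q.1 p.2) / (2 * (K + 1)) else 0 := by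
  unfold stFinLevel
  rw [mhKernel_of_ne hqp, mul_mhRate (stFinLaw_pos hμ), stFinProposal_symm q p]
  by_cases h : q.2 = p.2 ∧ (q.1.val = p.1.val + 1 ∨ p.1.val = q.1.val + 1)
  · have hT : stFinProposal p q = 1 / 2 := if_pos h
    rw [if_pos h, hT]
    unfold stFinLaw
    rw [h.1]
    have e : ∀ a : ℝ, a / (K + 1) * (1 / 2) = a / (2 * (K + 1)) := fun a => by
      rw [div_mul_div_comm, mul_one, mul_comm ((K : ℝ) + 1) 2]
    rw [e, e, min_div_div_right (by positivity)]
  · have hT : stFinProposal p q = 0 := if_neg h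
    rw [if_neg h, hT, mul_zero, mul_zero, min_self]

/-- The level move never changes the configuration: `L((k,x),(l,y)) = 0` for `y ≠ x`. [ours] -/
theorem stFinLevel_eq_zero_of_ne {p q : Fin (K + 1) × S} (h : q.2 ≠ p.2) : stFinLevel μ p q = 0 := by
  have hqp : q ≠ p := fun e => h (by rw [e])
  unfold stFinLevel
  rw [mhKernel_of_ne hqp, mhRate_of_symm stFinProposal_symm stFinProposal_nonneg]
  unfold stFinProposal
  rw [if_neg (fun hh => h hh.1), zero_mul]

/-- Within a level the move contributes nothing to a Dirichlet form: `L((k,x),(k,y))·(f(k,x) − f(k,y))² = 0`.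
[ours] -/
theorem stFinLevel_sameLevel_mul_sq (k : Fin (K + 1)) (x y : S) (f : Fin (K + 1) × S → ℝ) :
    stFinLevel μ (k, x) (k, y) * (f (k, x) - f (k, y)) ^ 2 = 0 := by
  by_cases h : y = x
  · subst h
    simp
  · rw [stFinLevel_eq_zero_of_ne (p := (k, x)) (q := (k, y)) h, zero_mul]

/-! ## §3 The within-level update and the sampler -/

/-- The within-level update: at level `k` move the configuration with `M_k`, keep the level. [ours] -/
def stFinWithin (M : Fin (K + 1) → Matrix S S ℝ) : Matrix (Fin (K + 1) × S) (Fin (K + 1) × S) ℝ :=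
  Matrix.of fun p q => if q.1 = p.1 then M p.1 p.2 q.2 else 0

omit [Fintype S] [DecidableEq S] in
/-- Entries of the within-level update. [ours] -/
theorem stFinWithin_apply (M : Fin (K + 1) → Matrix S S ℝ) (p q : Fin (K + 1) × S) :
    stFinWithin M p q = if q.1 = p.1 then M p.1 p.2 q.2 else 0 := rfl

variable {M : Fin (K + 1) → Matrix S S ℝ}

omit [DecidableEq S] in
/-- The within-level update is a transition matrix when every `M_k` is. [ours] -/
theorem stFinWithin_isRowStochastic (hM : ∀ k, IsRowStochastic (M k)) :
    IsRowStochastic (stFinWithin M) := by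
  refine ⟨fun p q => ?_, fun p => ?_⟩
  · rw [stFinWithin_apply]
    split_ifs
    · exact (hM p.1).1 _ _
    · exact le_rfl
  · simp_rw [stFinWithin_apply]
    rw [Fintype.sum_prod_type]
    simp_rw [Finset.sum_ite_irrel, Finset.sum_const_zero]
    rw [Finset.sum_ite_eq' univ p.1, if_pos (mem_univ _)]
    exact (hM p.1).2 _

omit [Fintype S] [DecidableEq S] in
/-- The within-level update is in detailed balance with the target when every `M_k` is with `μ_k`. [ours] -/
theorem stFinWithin_detailedBalance (hMrev : ∀ k, DetailedBalance (μ k) (M k)) :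
    DetailedBalance (stFinLaw μ) (stFinWithin M) := by
  intro p q
  rw [stFinWithin_apply, stFinWithin_apply]
  unfold stFinLaw
  by_cases h : q.1 = p.1
  · rw [if_pos h, if_pos h.symm, h, div_mul_eq_mul_div, div_mul_eq_mul_div, hMrev p.1 p.2 q.2]
  · rw [if_neg h, if_neg (Ne.symm h), mul_zero, mul_zero]

/-- The RANDOM-SCAN SIMULATED-TEMPERING SAMPLER on a finite configuration space: with probability `t` a
Metropolis level move, with probability `1 − t` a within-level update. [ours] -/
def stFinSampler (t : ℝ) (μ : Fin (K + 1) → S → ℝ) (M : Fin (K + 1) → Matrix S S ℝ) :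
    Matrix (Fin (K + 1) × S) (Fin (K + 1) × S) ℝ :=
  Matrix.of fun p q => t * stFinLevel μ p q + (1 - t) * stFinWithin M p q

/-- Entries of the sampler. [ours] -/
theorem stFinSampler_apply (t : ℝ) (μ : Fin (K + 1) → S → ℝ) (M : Fin (K + 1) → Matrix S S ℝ)
    (p q : Fin (K + 1) × S) :
    stFinSampler t μ M p q = t * stFinLevel μ p q + (1 - t) * stFinWithin M p q := rfl

variable {t : ℝ}

/-- The sampler is a transition matrix (`0 ≤ t ≤ 1`). [ours] -/
theorem stFinSampler_isRowStochastic (hμ : ∀ k x, 0 < μ k x) (hM : ∀ k, IsRowStochastic (M k))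
    (ht0 : 0 ≤ t) (ht1 : t ≤ 1) : IsRowStochastic (stFinSampler t μ M) := by
  refine ⟨fun p q => ?_, fun p => ?_⟩
  · rw [stFinSampler_apply]
    exact add_nonneg (mul_nonneg ht0 ((stFinLevel_isRowStochastic hμ).1 p q))
      (mul_nonneg (by linarith) ((stFinWithin_isRowStochastic hM).1 p q))
  · simp_rw [stFinSampler_apply]
    rw [Finset.sum_add_distrib, ← Finset.mul_sum, ← Finset.mul_sum, (stFinLevel_isRowStochastic hμ).2 p,
      (stFinWithin_isRowStochastic hM).2 p]
    ring

/-- **The sampler is in DETAILED BALANCE with the target** (both moves are). [ours] -/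
theorem stFinSampler_detailedBalance (hμ : ∀ k x, 0 < μ k x) (hMrev : ∀ k, DetailedBalance (μ k) (M k)) :
    DetailedBalance (stFinLaw μ) (stFinSampler t μ M) := by
  intro p q
  rw [stFinSampler_apply, stFinSampler_apply]
  have h1 := stFinLevel_detailedBalance hμ p q
  have h2 := stFinWithin_detailedBalance hMrev p q
  calc stFinLaw μ p * (t * stFinLevel μ p q + (1 - t) * stFinWithin M p q)
      = t * (stFinLaw μ p * stFinLevel μ p q) + (1 - t) * (stFinLaw μ p * stFinWithin M p q) := by ring
    _ = t * (stFinLaw μ q * stFinLevel μ q p) + (1 - t) * (stFinLaw μ q * stFinWithin M q p) := by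
        rw [h1, h2]
    _ = stFinLaw μ q * (t * stFinLevel μ q p + (1 - t) * stFinWithin M q p) := by ring

/-! ## §4 The block structure along the levels (`blk = Prod.fst`) -/

omit [DecidableEq S] in
/-- Summing over the block of level `k` is summing over the configurations at level `k`. [ours] -/
theorem sum_block_fst (k : Fin (K + 1)) (g : Fin (K + 1) × S → ℝ) :
    ∑ p ∈ block (Prod.fst : Fin (K + 1) × S → Fin (K + 1)) k, g p = ∑ y, g (k, y) := by
  unfold block
  rw [Finset.sum_filter, Fintype.sum_prod_type, Finset.sum_comm]
  simp_rw [Finset.sum_ite_eq' univ k, if_pos (mem_univ _)]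

omit [DecidableEq S] in
/-- An indicator of the level restricts a sum over the state space to one level. [ours] -/
theorem sum_ite_fst_eq (k : Fin (K + 1)) (F : Fin (K + 1) × S → ℝ) :
    ∑ q : Fin (K + 1) × S, (if q.1 = k then F q else 0) = ∑ y, F (k, y) := by
  rw [← Finset.sum_filter]
  exact sum_block_fst k F

omit [DecidableEq S] in
/-- Every level carries mass `1/(K+1)` (exact weights). [ours] -/
theorem stFin_blockMass (hμ1 : ∀ k, ∑ x, μ k x = 1) (k : Fin (K + 1)) :
    blockMass (stFinLaw μ) Prod.fst k = 1 / (K + 1) := by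
  unfold blockMass
  rw [sum_block_fst]
  unfold stFinLaw
  rw [← Finset.sum_div, hμ1]

omit [DecidableEq S] in
/-- The block law of level `k` is `μ_k` (carried on level `k`). [ours] -/
theorem stFin_blockLaw (hμ1 : ∀ k, ∑ x, μ k x = 1) (k : Fin (K + 1)) (p : Fin (K + 1) × S) :
    blockLaw (stFinLaw μ) Prod.fst k p = if p.1 = k then μ k p.2 else 0 := by
  unfold blockLaw
  rw [stFin_blockMass hμ1]
  split_ifs with h
  · unfold stFinLaw
    rw [← h]
    field_simp
  · rfl

omit [DecidableEq S] in
/-- Integrals against the block law of level `k` are integrals against `μ_k` of the level-`k` slice. [ours] -/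
theorem sum_stFin_blockLaw_mul (hμ1 : ∀ k, ∑ x, μ k x = 1) (k : Fin (K + 1)) (g : Fin (K + 1) × S → ℝ) :
    ∑ p, blockLaw (stFinLaw μ) Prod.fst k p * g p = ∑ y, μ k y * g (k, y) := by
  simp_rw [stFin_blockLaw hμ1, ite_mul, zero_mul]
  rw [sum_ite_fst_eq k (fun p => μ k p.2 * g p)]

omit [DecidableEq S] in
/-- The block variance of level `k` is the `μ_k`-variance of the slice. [ours] -/
theorem stFin_lawVariance_blockLaw (hμ1 : ∀ k, ∑ x, μ k x = 1) (k : Fin (K + 1))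
    (f : Fin (K + 1) × S → ℝ) :
    lawVariance (blockLaw (stFinLaw μ) Prod.fst k) f = lawVariance (μ k) (fun y => f (k, y)) := by
  unfold lawVariance lawMean
  rw [sum_stFin_blockLaw_mul hμ1 k f]
  exact sum_stFin_blockLaw_mul hμ1 k _

/-- The within-level update never leaves its block: it does not contribute to the escape probability, which
is therefore at most `t` (the chance that a level move is attempted at all). [ours] -/
theorem stFin_escapeProb_le (hμ : ∀ k x, 0 < μ k x) (ht0 : 0 ≤ t) (p : Fin (K + 1) × S) :
    escapeProb (stFinSampler t μ M) Prod.fst p ≤ t := by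
  unfold escapeProb
  have h : ∀ q ∈ univ.filter (fun q : Fin (K + 1) × S => q.1 ≠ p.1),
      stFinSampler t μ M p q = t * stFinLevel μ p q := by
    intro q hq
    rw [Finset.mem_filter] at hq
    rw [stFinSampler_apply, stFinWithin_apply, if_neg hq.2, mul_zero, add_zero]
  rw [Finset.sum_congr rfl h, ← Finset.mul_sum]
  calc t * ∑ q ∈ univ.filter (fun q : Fin (K + 1) × S => q.1 ≠ p.1), stFinLevel μ p q
      ≤ t * ∑ q, stFinLevel μ p q :=
        mul_le_mul_of_nonneg_left (Finset.sum_le_sum_of_subset_of_nonneg (filter_subset _ _)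
          fun q _ _ => (stFinLevel_isRowStochastic hμ).1 p q) ht0
    _ = t := by rw [(stFinLevel_isRowStochastic hμ).2 p, mul_one]

/-- **The restriction chain of level `k` is the within-level update, slowed by `1 − t`:** its Dirichlet form
for the block law is exactly `(1 − t)·𝓔_{μ_k}(M_k; f(k,·))` (the rejected level moves are diagonal). [ours] -/
theorem stFin_dirichletForm_restriction (hμ1 : ∀ k, ∑ x, μ k x = 1) (k : Fin (K + 1))
    (f : Fin (K + 1) × S → ℝ) :
    dirichletForm (blockLaw (stFinLaw μ) Prod.fst k) (restrictionChain (stFinSampler t μ M) Prod.fst) f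
      = (1 - t) * dirichletForm (μ k) (M k) (fun y => f (k, y)) := by
  have inner : ∀ x : S, ∑ q, restrictionChain (stFinSampler t μ M) Prod.fst (k, x) q * (f (k, x) - f q) ^ 2
      = (1 - t) * ∑ y, M k x y * (f (k, x) - f (k, y)) ^ 2 := by
    intro x
    simp_rw [restrictionChain_mul_sq_sub, ite_mul, zero_mul]
    rw [sum_ite_fst_eq ((k, x).1) (fun q => stFinSampler t μ M (k, x) q * (f (k, x) - f q) ^ 2),
      Finset.mul_sum]
    refine sum_congr rfl fun y _ => ?_
    rw [stFinSampler_apply, add_mul, mul_assoc, stFinLevel_sameLevel_mul_sq, mul_zero, zero_add,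
      stFinWithin_apply, if_pos rfl, mul_assoc]
  have key : ∑ p, ∑ q, blockLaw (stFinLaw μ) Prod.fst k p
        * restrictionChain (stFinSampler t μ M) Prod.fst p q * (f p - f q) ^ 2
      = (1 - t) * ∑ x, ∑ y, μ k x * M k x y * (f (k, x) - f (k, y)) ^ 2 := by
    simp_rw [mul_assoc, ← Finset.mul_sum]
    rw [sum_stFin_blockLaw_mul hμ1 k]
    simp_rw [inner]
    rw [Finset.mul_sum]
    refine sum_congr rfl fun x _ => ?_
    rw [mul_left_comm, Finset.mul_sum, Finset.mul_sum]
  unfold dirichletForm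
  rw [key]
  ring

/-- **The flow between two different levels is the overlap:** `blockFlow i j = [|i − j| = 1]·t·ov(i,j)/(2(K+1))`
(`i ≠ j`) — the projection chain moves `i → j` with probability `(t/2)·Σ_x min{μ_i(x),μ_j(x)}`, the
within-level updates being invisible to it. [ours] -/
theorem stFin_blockFlow_of_ne (hμ : ∀ k x, 0 < μ k x) {i j : Fin (K + 1)} (hij : i ≠ j) :
    blockFlow (stFinLaw μ) (stFinSampler t μ M) Prod.fst i j
      = if (j.val = i.val + 1 ∨ i.val = j.val + 1) then t * stFinOverlap μ i j / (2 * (K + 1)) else 0 := by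
  unfold blockFlow
  rw [sum_block_fst]
  simp_rw [sum_block_fst]
  have h : ∀ x y : S, stFinLaw μ (i, x) * stFinSampler t μ M (i, x) (j, y)
      = t * (if y = x ∧ (j.val = i.val + 1 ∨ i.val = j.val + 1)
          then min (μ i x) (μ j x) / (2 * (K + 1)) else 0) := by
    intro x y
    have hq : ((j, y) : Fin (K + 1) × S) ≠ (i, x) := fun e => hij (Prod.mk.inj e).1.symm
    rw [stFinSampler_apply, stFinWithin_apply, if_neg (Ne.symm hij), mul_zero, add_zero, mul_left_comm,
      stFinLaw_mul_stFinLevel hμ hq]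
  simp_rw [h, ← Finset.mul_sum, ite_and]
  simp_rw [Finset.sum_ite_eq' univ, if_pos (mem_univ _)]
  split_ifs with hadj
  · unfold stFinOverlap
    rw [← Finset.sum_div]
    ring
  · simp

end Basic

end Summit.Ventures.LatticeQCDFlow.Scaling

end
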